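import Summits.BirchSwinnertonDyer.BirchSwinnertonDyer.Theses.KatoDescentPotSupersingular
import Summits.BirchSwinnertonDyer.BirchSwinnertonDyer.Theorems.KatoDescentPotSupersingularWildLowerKimRoad
import Summits.BirchSwinnertonDyer.BirchSwinnertonDyer.Theorems.KatoDescentPotSupersingularWildLowerKimCerts
import Summits.BirchSwinnertonDyer.Rank1Residual.Additive.X4ThreeKuriharaCertKernel
import Literature.NumberTheory.EllipticCurves.ManinConstantConductorLe300000
import HarnessLib

/-!
# Route `KatoDescentPotSupersingular` (rung K9, cell `bsd-potss`): child crux `WildLowerIntrinsicNonCM`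
# (item stmt-BirchSwinnertonDyer-19663) — the registered stub `stub_intr_kimRows` BY NAME modulo ONE
# unit Kurihara number per row, and the WILD per-row RECORD KERNEL on the REFEREED Kim-at-3 leaf
# (a `--supports … --as helper` file; seat `bsd-potss-k9-kur3`, generation 0)

The child crux's registered skeleton (`Cruxes/WildLowerIntrinsicNonCM/Lines/birth.lean`, planner
bsd-potss-plan g14) cuts the intrinsic non-CM wild rank-`0` rows at `3` by road; its stub
`stub_intr_kimRows` is L₀ (`MissingLowerBoundAt W 3`) on the KIM–KURIHARA rows: `3`-adic tower onto,
`E(ℚ₃)[3] = 0`, `3 ∤ ∏ c_ℓ`. On these rows rung W2's leaf `N11.KimAtThreeRankZeroPUB` (C.-H. Kim,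
arXiv:2505.09121 Thm. 1.1/1.2 at `p = 3` for curves with the tower onto and `E(ℚ₃)[3] = 0`, refereed
as a CELL theorem of `bsd-addord`; NO hypothesis on the reduction type at `3`, so the wild additive rows
are inside) turns ONE unit mod-`3` Kurihara number `δ̃_n`, `n = ℓ₁ℓ₂` a cyclic Kolyvagin level, into
`BSD₃` at the pair (`N11.bsdp_three_of_kimAtThreeRankZeroPUB_of_kuriharaUnitAt`), hence L₀.

* §1 `stub_intr_kimRows_of_kimAtThree_of_kuriharaUnits` — the stub's `Sig` statement VERBATIM (the
  skeleton's reducible abbreviations `KimRows W` / `Intrinsic W` written out, so the owner's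
  `WildLowerIntrinsicNonCM_of` consumes the theorem by `exact`), from the leaf `hKim`, GZK,
  modularity and ONE displayed hypothesis `hKur`: on every such row an optimal-type datum with the
  period transfer and a unit Kurihara number (`X4.KuriharaUnitAt W 3 D.f`). CLASS-WIDE `hKur` is
  Kurihara's conjecture on these rows (⟺ Kato's IMC at `3` by Kim's Conj. 1.3) — the stub's open
  content, unchanged; PER ROW it is a finite modular-symbol certificate (this seat's harvest, kit job
  `K9KUR3`: census TSV attached to the item as evidence). `stub_intr_kimRows_of_kimAtThree_of_memberCerts`
  is the class form (certificate at ONE globally minimal isogenous member, transported by Cassels).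
* §2 the WILD RECORD KERNEL on the refereed leaf — the unit-row record shape of team n1011's
  `X4RankZero.bsdp_three_of_intModel_of_optimal_of_towerSurj_of_kuriharaUnitAt` (K25 ANNOUNCED record
  `hK25s`) with the announced record REPLACED by the refereed leaf `hKim` plus its `t = 0` binder:
  `bsdp_three_wild_of_optimal_of_towerSurj_of_t0_of_kuriharaUnitAt` (optimal datum at level
  `N ≤ 130000`, Agashe–Ribet–Stein Thm. 2.6), `…_le_300000` (Cremona's completed computation to
  `300000`, as rendered by Česnavičius–Neururer–Saha 2023 §1) and `…_of_maninUnit` (the displayed Manin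
  binder `hc3 : ¬ 3 ∣ c_D` for `N > 300000`). Each returns `BSDp W 3 ∧ MissingPPartAt W 3` — BOTH
  halves, whatever `ord₃ #Ш_an` is — from: the tower, `#E(ℚ₃)[3] = 1`, `r_an = 0`, `3 ∤ ∏ c_ℓ`, the
  datum, ONE unit Kurihara number. No reduction-type input (`ClassO6` is not needed by the leaf).

HONEST LABEL. Every theorem is CONDITIONAL: on the leaf `N11.KimAtThreeRankZeroPUB` (an explicit
hypothesis; a refereed cell memo, NOT a Literature fact), on GZK / modularity / (§1 class form) Cassels,
on a Manin-constant named fact or binder, and on per-row certificate SLOTS (`hKur`, `hK`) that the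
kernel cannot fill (periods). Per-row instances close NO class: the item 19663 and the stub stay OPEN
(class-wide = Kurihara's conjecture ⟺ Kato Conj. 12.10 at the additive prime `3`, an open problem).
Nothing is booked; BSD is not proved by any of this. Seat `bsd-potss-k9-kur3` (prover), generation 0.

References: [Kim2025RefinedTNC] Thm. 1.1, Thm. 1.2 (rk 0) (PDF pp. 5–6); [Kim2022StructureSelmer]
Thm. 1.10 (1), Conj. 1.3, §1.4.3; [Kurihara2014] §1; [AgasheRibetStein2006] Thm. 2.6 (p. 619);
[CesnaviciusNeururerSaha2023] §1; [Cremona1997] §2.8; [MilneADT2006] Thm. I.7.3; [Miller2011LMS]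
Def. 1.1; memo `run/shared/lean/pub/bsd-addord/kim3/KIM3-PROOF.md` (Thm. A, Cor. C).
-/

set_option autoImplicit false
-- sibling precedent (`KatoDescentPotSupersingularAssembly.lean`): the directory name repeats the summit name
set_option linter.dupNamespace false

noncomputable section

open scoped Classical

namespace Summit.BirchSwinnertonDyer.BirchSwinnertonDyer.Theorems.KimRowsHarvest

open WeierstrassCurve Literature.NumberTheory.EllipticCurves
  Literature.NumberTheory.EllipticCurves.ModularForms
  Literature.NumberTheory.EllipticCurves.Rank1Residual
  Literature.NumberTheory.EllipticCurves.Rank1Residual.Typed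
  Literature.NumberTheory.EllipticCurves.AgasheRibetStein2006
  Summit.BirchSwinnertonDyer.Rank1Residual.Additive
  Summit.BirchSwinnertonDyer.Rank1Residual
  Summit.BirchSwinnertonDyer.Rank1Residual.O6
  Summit.BirchSwinnertonDyer.BirchSwinnertonDyer.Theses.KatoDescentPotSupersingular
  Summit.BirchSwinnertonDyer.BirchSwinnertonDyer.Theorems

/-! ## §1 The stub BY NAME modulo one unit Kurihara number per row -/

/-- **`stub_intr_kimRows` from rung W2's leaf and ONE unit Kurihara number per row.** Granted
`N11.KimAtThreeRankZeroPUB` (`hKim`), GZK and modularity, the registered stub follows from the displayed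
hypothesis `hKur`: every intrinsic non-CM wild rank-`0` Kim row carries a modular parametrisation datum
`D` with the period transfer (`Ω(W) = u·Ω⁺_{D.f}`, `|u|₃ = 1` — discharged on an optimal datum with
`3 ∤ c_D` by `X4.periodTransfer_of_optimal`) and a UNIT mod-`3` Kurihara number at a cyclic Kolyvagin
level (`X4.KuriharaUnitAt W 3 D.f`). Class-wide `hKur` is Kurihara's conjecture on these rows (the
stub's open content); per row it is a finite certificate. Conditional; the item is NOT closed.
[cite: Kim2025RefinedTNC, Thm. 1.2 (rk 0) (PDF p. 6)] [cite: Kim2022StructureSelmer, Thm. 1.10 (1), Conj. 1.3]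
[cite: Kurihara2014, §1] [cite: Miller2011LMS, Def. 1.1] -/
theorem stub_intr_kimRows_of_kimAtThree_of_kuriharaUnits (hKim : N11.KimAtThreeRankZeroPUB)
    (hGZK : rank_eq_analyticRank_of_analyticRank_le_one) (hmod : hasEntireLFunction_rat)
    (hKur : ∀ (W : WeierstrassCurve ℚ) [W.IsElliptic] [W.IsGloballyMinimal],
      W.analyticRank = 0 → ClassO6 W 3 →
      ((∀ n : ℕ, W.HasSurjectiveModNGaloisRep (3 ^ n : ℕ)) ∧
        Nat.card {Q : (W.baseChange ℚ_[3]).toAffine.Point // (3 : ℕ) • Q = 0} = 1 ∧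
        ¬ 3 ∣ W.tamagawaProduct) →
      ¬ W.HasCM →
      (∀ (W' : WeierstrassCurve ℚ) [W'.IsElliptic] [W'.IsGloballyMinimal], IsIsogenous W W' →
        ∀ q' : ℚ, shaAn W' = (q' : ℂ) → 0 < padicValRat 3 q') →
        ∃ (N : ℕ) (_ : NeZero N) (D : ModularParametrizationData W N),
          (∃ u : ℚ, ‖(u : ℚ_[3])‖ = 1 ∧ W.realPeriodRat = u * plusPeriod D.f) ∧
            X4.KuriharaUnitAt W 3 D.f) :
    ∀ (W : WeierstrassCurve ℚ) [W.IsElliptic] [W.IsGloballyMinimal] [Fact (3 : ℕ).Prime],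
      W.analyticRank = 0 → ClassO6 W 3 →
      ((∀ n : ℕ, W.HasSurjectiveModNGaloisRep (3 ^ n : ℕ)) ∧
        Nat.card {Q : (W.baseChange ℚ_[3]).toAffine.Point // (3 : ℕ) • Q = 0} = 1 ∧
        ¬ 3 ∣ W.tamagawaProduct) →
      ¬ W.HasCM →
      (∀ (W' : WeierstrassCurve ℚ) [W'.IsElliptic] [W'.IsGloballyMinimal], IsIsogenous W W' →
        ∀ q' : ℚ, shaAn W' = (q' : ℂ) → 0 < padicValRat 3 q') →
      MissingLowerBoundAt W 3 := by
  intro W _ _ _ hr hO hK hCM hI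
  obtain ⟨N, hN, D, hper, hKu⟩ := hKur W hr hO hK hCM hI
  haveI := hN
  exact missingLowerBoundAt_wild_of_kimAtThree_of_kuriharaUnitAt hKim hGZK hmod W hr hO hK.1 hK.2.1 D
    hper hK.2.2 hKu

/-- **`stub_intr_kimRows` from the leaf and ONE unit Kurihara number at SOME globally minimal member
of each row's class** (the census currency: the harvest certifies the `#Ш_an`-minimal member; Cassels'
isogeny invariance of the BSD quotient — `hCassels` — transports L₀ along the class, through k9-c2's
`missingLowerBoundAt_wild_of_isIsogenous_kimUnitCert`). The member `W'` must itself be a Kim row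
(tower onto — automatic along a class of `3`-power-free isogenies only, so displayed —,
`E'(ℚ₃)[3] = 0`, `3 ∤ ∏ c_ℓ(W')`). Conditional; the item is NOT closed.
[cite: Kim2025RefinedTNC, Thm. 1.2 (rk 0)] [cite: MilneADT2006, Thm. I.7.3] [cite: Miller2011LMS, Def. 1.1] -/
theorem stub_intr_kimRows_of_kimAtThree_of_memberCerts (hKim : N11.KimAtThreeRankZeroPUB)
    (hCassels : bsdRHS_eq_of_isIsogenous) (hGZK : rank_eq_analyticRank_of_analyticRank_le_one)
    (hmod : hasEntireLFunction_rat)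
    (hKur : ∀ (W : WeierstrassCurve ℚ) [W.IsElliptic] [W.IsGloballyMinimal],
      W.analyticRank = 0 → ClassO6 W 3 →
      ((∀ n : ℕ, W.HasSurjectiveModNGaloisRep (3 ^ n : ℕ)) ∧
        Nat.card {Q : (W.baseChange ℚ_[3]).toAffine.Point // (3 : ℕ) • Q = 0} = 1 ∧
        ¬ 3 ∣ W.tamagawaProduct) →
      ¬ W.HasCM →
      (∀ (W' : WeierstrassCurve ℚ) [W'.IsElliptic] [W'.IsGloballyMinimal], IsIsogenous W W' →
        ∀ q' : ℚ, shaAn W' = (q' : ℂ) → 0 < padicValRat 3 q') →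
        ∃ (W' : WeierstrassCurve ℚ) (_ : W'.IsElliptic) (_ : W'.IsGloballyMinimal),
          IsIsogenous W W' ∧
          ((∀ n : ℕ, W'.HasSurjectiveModNGaloisRep (3 ^ n : ℕ)) ∧
            Nat.card {Q : (W'.baseChange ℚ_[3]).toAffine.Point // (3 : ℕ) • Q = 0} = 1 ∧
            ¬ 3 ∣ W'.tamagawaProduct) ∧
          ∃ (N : ℕ) (_ : NeZero N) (D : ModularParametrizationData W' N),
            (∃ u : ℚ, ‖(u : ℚ_[3])‖ = 1 ∧ W'.realPeriodRat = u * plusPeriod D.f) ∧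
              X4.KuriharaUnitAt W' 3 D.f) :
    ∀ (W : WeierstrassCurve ℚ) [W.IsElliptic] [W.IsGloballyMinimal] [Fact (3 : ℕ).Prime],
      W.analyticRank = 0 → ClassO6 W 3 →
      ((∀ n : ℕ, W.HasSurjectiveModNGaloisRep (3 ^ n : ℕ)) ∧
        Nat.card {Q : (W.baseChange ℚ_[3]).toAffine.Point // (3 : ℕ) • Q = 0} = 1 ∧
        ¬ 3 ∣ W.tamagawaProduct) →
      ¬ W.HasCM →
      (∀ (W' : WeierstrassCurve ℚ) [W'.IsElliptic] [W'.IsGloballyMinimal], IsIsogenous W W' →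
        ∀ q' : ℚ, shaAn W' = (q' : ℂ) → 0 < padicValRat 3 q') →
      MissingLowerBoundAt W 3 := by
  intro W _ _ _ hr hO hK hCM hI
  obtain ⟨W', hE', hM', hiso, hK', N, hN, D, hper, hKu⟩ := hKur W hr hO hK hCM hI
  haveI := hE'; haveI := hM'; haveI := hN
  exact missingLowerBoundAt_wild_of_isIsogenous_kimUnitCert hKim hCassels hGZK hmod W hr hO W' hiso
    hK'.1 hK'.2.1 D hper hK'.2.2 hKu

/-! ## §2 The wild per-row record kernel on the refereed leaf -/

/-- **WILD unit-row record shape on the REFEREED leaf, optimal datum at level `N ≤ 130000`.**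
Globally minimal elliptic `W/ℚ`; the `3`-adic tower onto (`htower`; in records a kernel Frobenius /
order-nine trace certificate); `#E(ℚ₃)[3] = 1` (`ht0`; in records the kernel decider
`LocalThreeTorsionDecider`); `r_an = 0` (`hr`); `3 ∤ ∏ c_ℓ` (`htam`; in records a kernel Tamagawa
numeral); an OPTIMAL datum `D` at level `N ≤ 130000` (`hopt`, so `3 ∤ c_D` by Agashe–Ribet–Stein
Thm. 2.6 `h26` and the period transfer by `X4.periodTransfer_of_optimal`); ONE unit Kurihara number of
`D.f` at a cyclic level (`hK`, the EVIDENCE binder) ⟹ `BSD(E,3) ∧ MissingPPartAt W 3`, CONDITIONAL on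
`N11.KimAtThreeRankZeroPUB` (`hKim`), GZK, modularity. Team n1011's T-a2-REC unit-row shape with the
ANNOUNCED K25 record replaced by the refereed leaf + its `t = 0` binder; NO reduction-type input.
Per pair; nothing booked. [cite: Kim2025RefinedTNC, Thm. 1.1 ("BSD") and Thm. 1.2 (rk 0) (PDF pp. 5–6)]
[cite: AgasheRibetStein2006, Thm. 2.6 (p. 619)] [cite: Cremona1997, §2.8 (p. 26)] [cite: Miller2011LMS, Def. 1.1] -/
theorem bsdp_three_wild_of_optimal_of_towerSurj_of_t0_of_kuriharaUnitAt
    (hKim : N11.KimAtThreeRankZeroPUB)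
    (hGZK : rank_eq_analyticRank_of_analyticRank_le_one) (hmod : hasEntireLFunction_rat)
    (h26 : cremona_abs_maninConstant_eq_one_of_level_le)
    (W : WeierstrassCurve ℚ) [W.IsElliptic] [W.IsGloballyMinimal]
    (htower : ∀ n : ℕ, W.HasSurjectiveModNGaloisRep (3 ^ n : ℕ))
    (ht0 : Nat.card {Q : (W.baseChange ℚ_[3]).toAffine.Point // (3 : ℕ) • Q = 0} = 1)
    (hr : W.analyticRank = 0) (htam : ¬ 3 ∣ W.tamagawaProduct)
    {N : ℕ} [NeZero N] (hN : N ≤ 130000) (D : ModularParametrizationData W N)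
    (hopt : ∀ z ∈ D.L.lattice, ∃ w ∈ periodLattice D.f, z = D.c * w)
    (hK : haveI : Fact (Nat.Prime 3) := ⟨Nat.prime_three⟩; X4.KuriharaUnitAt W 3 D.f) :
    haveI : Fact (Nat.Prime 3) := ⟨Nat.prime_three⟩
    BSDp W 3 ∧ MissingPPartAt W 3 := by
  haveI : Fact (Nat.Prime 3) := ⟨Nat.prime_three⟩
  have hc : ¬ (3 : ℤ) ∣ D.maninConstant :=
    not_dvd_maninConstant_of_level_le h26 W D hopt hN Nat.prime_three
  have hper : ∃ u : ℚ, ‖(u : ℚ_[3])‖ = 1 ∧ W.realPeriodRat = u * plusPeriod D.f :=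
    X4.periodTransfer_of_optimal 3 D hopt hc
  have hL : W.entireLFunction 1 ≠ 0 := (W.analyticRank_eq_zero_iff_holds (hmod W)).mp hr
  have hB : BSDp W 3 :=
    N11.bsdp_three_of_kimAtThreeRankZeroPUB_of_kuriharaUnitAt W hKim hGZK htower ht0 hL D hper htam hK
  haveI : Finite W.sha := (hGZK W (by rw [hr]; exact zero_le_one)).2
  exact ⟨hB, missingPPartAt_of_bsdp W 3 hB⟩

/-- **WILD unit-row record shape on the REFEREED leaf, optimal datum at level `N ≤ 300000`** (the
Manin input is Cremona's completed computation to `300000` as rendered by Česnavičius–Neururer–Saha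
2023 §1, `h300k`; everything else as in the `130000` shape). Per pair; nothing booked.
[cite: Kim2025RefinedTNC, Thm. 1.1 ("BSD") and Thm. 1.2 (rk 0)] [cite: CesnaviciusNeururerSaha2023, §1]
[cite: Cremona1997, §2.8 (p. 26)] [cite: Miller2011LMS, Def. 1.1] -/
theorem bsdp_three_wild_of_optimal_le_300000_of_towerSurj_of_t0_of_kuriharaUnitAt
    (hKim : N11.KimAtThreeRankZeroPUB)
    (hGZK : rank_eq_analyticRank_of_analyticRank_le_one) (hmod : hasEntireLFunction_rat)
    (h300k : cremona_abs_maninConstant_eq_one_of_level_le_300000)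
    (W : WeierstrassCurve ℚ) [W.IsElliptic] [W.IsGloballyMinimal]
    (htower : ∀ n : ℕ, W.HasSurjectiveModNGaloisRep (3 ^ n : ℕ))
    (ht0 : Nat.card {Q : (W.baseChange ℚ_[3]).toAffine.Point // (3 : ℕ) • Q = 0} = 1)
    (hr : W.analyticRank = 0) (htam : ¬ 3 ∣ W.tamagawaProduct)
    {N : ℕ} [NeZero N] (hN : N ≤ 300000) (D : ModularParametrizationData W N)
    (hopt : ∀ z ∈ D.L.lattice, ∃ w ∈ periodLattice D.f, z = D.c * w)
    (hK : haveI : Fact (Nat.Prime 3) := ⟨Nat.prime_three⟩; X4.KuriharaUnitAt W 3 D.f) :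
    haveI : Fact (Nat.Prime 3) := ⟨Nat.prime_three⟩
    BSDp W 3 ∧ MissingPPartAt W 3 := by
  haveI : Fact (Nat.Prime 3) := ⟨Nat.prime_three⟩
  have hc : ¬ (3 : ℤ) ∣ D.maninConstant :=
    not_dvd_maninConstant_of_level_le_300000 h300k W D hopt hN Nat.prime_three
  have hper : ∃ u : ℚ, ‖(u : ℚ_[3])‖ = 1 ∧ W.realPeriodRat = u * plusPeriod D.f :=
    X4.periodTransfer_of_optimal 3 D hopt hc
  have hL : W.entireLFunction 1 ≠ 0 := (W.analyticRank_eq_zero_iff_holds (hmod W)).mp hr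
  have hB : BSDp W 3 :=
    N11.bsdp_three_of_kimAtThreeRankZeroPUB_of_kuriharaUnitAt W hKim hGZK htower ht0 hL D hper htam hK
  haveI : Finite W.sha := (hGZK W (by rw [hr]; exact zero_le_one)).2
  exact ⟨hB, missingPPartAt_of_bsdp W 3 hB⟩

/-- **WILD unit-row record shape on the REFEREED leaf, LARGE LEVEL** (`N > 300000`: the Manin binder
`hc3 : ¬ 3 ∣ c_D` of the optimal datum is DISPLAYED — Cremona `opt_man`, evidence, never discharged
here; everything else as in the `130000` shape). Per pair; nothing booked.
[cite: Kim2025RefinedTNC, Thm. 1.1 ("BSD") and Thm. 1.2 (rk 0)] [cite: Cremona1997, §2.8 (p. 26)]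
[cite: Miller2011LMS, Def. 1.1] -/
theorem bsdp_three_wild_of_maninUnit_of_towerSurj_of_t0_of_kuriharaUnitAt
    (hKim : N11.KimAtThreeRankZeroPUB)
    (hGZK : rank_eq_analyticRank_of_analyticRank_le_one) (hmod : hasEntireLFunction_rat)
    (W : WeierstrassCurve ℚ) [W.IsElliptic] [W.IsGloballyMinimal]
    (htower : ∀ n : ℕ, W.HasSurjectiveModNGaloisRep (3 ^ n : ℕ))
    (ht0 : Nat.card {Q : (W.baseChange ℚ_[3]).toAffine.Point // (3 : ℕ) • Q = 0} = 1)
    (hr : W.analyticRank = 0) (htam : ¬ 3 ∣ W.tamagawaProduct)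
    {N : ℕ} [NeZero N] (D : ModularParametrizationData W N)
    (hopt : ∀ z ∈ D.L.lattice, ∃ w ∈ periodLattice D.f, z = D.c * w)
    (hc3 : ¬ (3 : ℤ) ∣ D.maninConstant)
    (hK : haveI : Fact (Nat.Prime 3) := ⟨Nat.prime_three⟩; X4.KuriharaUnitAt W 3 D.f) :
    haveI : Fact (Nat.Prime 3) := ⟨Nat.prime_three⟩
    BSDp W 3 ∧ MissingPPartAt W 3 := by
  haveI : Fact (Nat.Prime 3) := ⟨Nat.prime_three⟩
  have hper : ∃ u : ℚ, ‖(u : ℚ_[3])‖ = 1 ∧ W.realPeriodRat = u * plusPeriod D.f :=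
    X4.periodTransfer_of_optimal 3 D hopt hc3
  have hL : W.entireLFunction 1 ≠ 0 := (W.analyticRank_eq_zero_iff_holds (hmod W)).mp hr
  have hB : BSDp W 3 :=
    N11.bsdp_three_of_kimAtThreeRankZeroPUB_of_kuriharaUnitAt W hKim hGZK htower ht0 hL D hper htam hK
  haveI : Finite W.sha := (hGZK W (by rw [hr]; exact zero_le_one)).2
  exact ⟨hB, missingPPartAt_of_bsdp W 3 hB⟩

/-- **L₀ at EVERY member of the class of a certified wild Kim row** (record shape + Cassels transport):
a globally minimal member `W'` with the tower, `#E'(ℚ₃)[3] = 1`, `3 ∤ ∏ c_ℓ(W')`, an optimal datum at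
level `N ≤ 300000` and ONE unit Kurihara number gives `MissingLowerBoundAt W 3` at every globally
minimal `W` isogenous to `W'` with `r_an(W) = 0` — the census books CLASSES (all 1 114 Kim-row classes
of the k9-c2 ledger are single curves or have the certificate at the `#Ш_an`-minimal member).
Conditional; nothing booked. [cite: Kim2025RefinedTNC, Thm. 1.2 (rk 0)] [cite: MilneADT2006, Thm. I.7.3]
[cite: CesnaviciusNeururerSaha2023, §1] [cite: Miller2011LMS, Def. 1.1] -/
theorem missingLowerBoundAt_of_isIsogenous_wildKimRecord_le_300000
    (hKim : N11.KimAtThreeRankZeroPUB) (hCassels : bsdRHS_eq_of_isIsogenous)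
    (hGZK : rank_eq_analyticRank_of_analyticRank_le_one) (hmod : hasEntireLFunction_rat)
    (h300k : cremona_abs_maninConstant_eq_one_of_level_le_300000)
    (W : WeierstrassCurve ℚ) [W.IsElliptic] [W.IsGloballyMinimal] (hr : W.analyticRank = 0)
    (W' : WeierstrassCurve ℚ) [W'.IsElliptic] [W'.IsGloballyMinimal] (hiso : IsIsogenous W W')
    (htower : ∀ n : ℕ, W'.HasSurjectiveModNGaloisRep (3 ^ n : ℕ))
    (ht0 : Nat.card {Q : (W'.baseChange ℚ_[3]).toAffine.Point // (3 : ℕ) • Q = 0} = 1)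
    (htam : ¬ 3 ∣ W'.tamagawaProduct)
    {N : ℕ} [NeZero N] (hN : N ≤ 300000) (D : ModularParametrizationData W' N)
    (hopt : ∀ z ∈ D.L.lattice, ∃ w ∈ periodLattice D.f, z = D.c * w)
    (hK : haveI : Fact (Nat.Prime 3) := ⟨Nat.prime_three⟩; X4.KuriharaUnitAt W' 3 D.f) :
    haveI : Fact (Nat.Prime 3) := ⟨Nat.prime_three⟩
    MissingLowerBoundAt W 3 := by
  haveI : Fact (Nat.Prime 3) := ⟨Nat.prime_three⟩
  have hr' : W'.analyticRank = 0 := by rw [← analyticRank_eq_of_isIsogenous' hiso, hr]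
  have hr1 : W'.analyticRank ≤ 1 := by rw [hr']; exact zero_le_one
  have hlow : MissingLowerBoundAt W' 3 :=
    (lower_and_upper_of_missingPPartAt W' 3
      (bsdp_three_wild_of_optimal_le_300000_of_towerSurj_of_t0_of_kuriharaUnitAt hKim hGZK hmod h300k
        W' htower ht0 hr' htam hN D hopt hK).2).1
  exact TwistComparison.missingLowerBoundAt_of_isIsogenous W' W 3 hCassels hGZK hmod
    hiso.symm_of_charZero hr1 hlow

end Summit.BirchSwinnertonDyer.BirchSwinnertonDyer.Theorems.KimRowsHarvest

end
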